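import Summits.RiemannHypothesis.RiemannHypothesis.Theorems.OddSectorOddOneSignedWindowsFormDomainDilation
import Summits.RiemannHypothesis.RiemannHypothesis.Theorems.WeilParityEvenWinsArchRungs
import HarnessLib

/-!
# RiemannHypothesis / GroundBarta — rung 4 (`EvenWinsBeyondArch`, stmt-RiemannHypothesis-18807):
# the deflated Temple (Lehmann–Maehly) L-side programme, VII — the archimedean majorant of a `C²` window vector

Helper file (`--supports stmt-RiemannHypothesis-18807`), RH-free, Mathlib + landed tree files only, no
definitions, no named facts.

The window-image theorem (`…DeflationWindowImageRepr`, `dt_windowImage_repr`) needs, for a trial vector `v`, a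
square-integrable majorant `m` of the archimedean second differences inside the window,
`∫₀^∞ ρ(t) |2v(y) − v(y−t) − v(y+t)| dt ≤ m(y)` for `y ∈ (-c, c)`.  `dt_exists_majorant_of_contDiff` supplies it
for the certificates' trial vectors `v = g · 𝟙_{[-c,c]}`, `g ∈ C²(ℝ)` (polynomial × indicator Ritz vectors): inside
the distance `d(y) = c − |y|` to the edge the second differences are `≤ 2‖g''‖t²` (`dt_secondDiff_norm_le`, twice
the mean value theorem) and `ρ(t)t² ≤ t/2 + t²/4` (`dt_weilArchDensity_le_inv`); beyond it they are `≤ 4‖g‖` and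
`∫_d^∞ ρ ≤ (3/4) log⁺(1/d) + ∫_1^∞ ρ` (`dt_setIntegral_weilArchDensity_Ici_le`, the edge logarithm), and
`log⁺(1/d) ≤ 4 d^{-1/4}` is square integrable across the window.  Prover B, speedrun unit `sr-gb-rung-b` (gen 3).

References: E. Bombieri, Rend. Mat. Acc. Lincei (9) 11 (2000) 183–233, Thm 2 (the density `e^{t/2}/(2 sinh t)`).
-/

set_option linter.dupNamespace false

noncomputable section

open MeasureTheory Set Filter
open scoped Topology ENNReal NNReal

namespace Summit.RiemannHypothesis.RiemannHypothesis.Theorems.EvenWinsBeyondArch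

open Literature.NumberTheory.LFunctions
open Summit.RiemannHypothesis.RiemannHypothesis.Theorems.OddSector (weilArchDensity_le_exp_neg)
open Summit.RiemannHypothesis.RiemannHypothesis.Theorems.WeilParity.EvenWinsArch (mul_weilArchDensity_le)

/-! ## Second differences of a `C²` function -/

/-- **Second differences of a `C²` function**: if `|g''| ≤ G₂` on `[y − t, y + t]` (`t ≥ 0`) then
`|2g(y) − g(y−t) − g(y+t)| ≤ 2 G₂ t²` (mean value theorem for `s ↦ g(y+s) + g(y−s)` on `[0, t]`, whose derivative
`g'(y+s) − g'(y−s)` is at most `2 G₂ t` by the mean value theorem for `g'`). -/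
theorem dt_secondDiff_norm_le {g : ℝ → ℝ} (hg : ContDiff ℝ 2 g) {y t G₂ : ℝ} (ht : 0 ≤ t)
    (hG₂ : ∀ s ∈ Icc (y - t) (y + t), ‖iteratedDeriv 2 g s‖ ≤ G₂) :
    ‖2 * g y - g (y - t) - g (y + t)‖ ≤ 2 * G₂ * t ^ 2 := by
  have hd1 : Differentiable ℝ g := hg.differentiable (by norm_num)
  have hd2 : Differentiable ℝ (deriv g) := by
    have := hg.differentiable_iteratedDeriv 1 (by norm_num)
    rwa [iteratedDeriv_one] at this
  have hdd : deriv (deriv g) = iteratedDeriv 2 g := by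
    rw [show (2 : ℕ) = 1 + 1 from rfl, iteratedDeriv_succ, iteratedDeriv_one]
  have hG₂0 : 0 ≤ G₂ := (norm_nonneg _).trans (hG₂ y ⟨by linarith, by linarith⟩)
  -- the derivative `g'` moves by at most `G₂ |Δ|` inside `[y - t, y + t]`
  have hlip : ∀ a ∈ Icc (y - t) (y + t), ∀ b ∈ Icc (y - t) (y + t),
      ‖deriv g b - deriv g a‖ ≤ G₂ * ‖b - a‖ := by
    intro a ha b hb
    refine Convex.norm_image_sub_le_of_norm_hasDerivWithin_le (f := deriv g) (f' := deriv (deriv g))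
      (fun x _ ↦ (hd2 x).hasDerivAt.hasDerivWithinAt) (fun x hx ↦ ?_) (convex_Icc _ _) ha hb
    rw [hdd]; exact hG₂ x hx
  -- `φ(s) = g(y+s) + g(y-s)` on `[0, t]`
  have hφ' : ∀ s, HasDerivAt (fun s ↦ g (y + s) + g (y - s)) (deriv g (y + s) - deriv g (y - s)) s := by
    intro s
    have h1 : HasDerivAt (fun s ↦ g (y + s)) (deriv g (y + s)) s :=
      ((hd1 (y + s)).hasDerivAt).comp_const_add y s
    have h2 : HasDerivAt (fun s ↦ g (y - s)) (-deriv g (y - s)) s :=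
      ((hd1 (y - s)).hasDerivAt).comp_const_sub y s
    exact (h1.add h2).congr_deriv (by ring)
  have hbound : ∀ s ∈ Icc 0 t, ‖deriv g (y + s) - deriv g (y - s)‖ ≤ 2 * G₂ * t := by
    intro s hs
    have h := hlip (y - s) ⟨by linarith [hs.2], by linarith [hs.1]⟩ (y + s) ⟨by linarith [hs.1], by linarith [hs.2]⟩
    have e : ‖(y + s) - (y - s)‖ = 2 * s := by
      rw [show (y + s) - (y - s) = 2 * s by ring, Real.norm_of_nonneg (by linarith [hs.1])]
    rw [e] at h
    calc ‖deriv g (y + s) - deriv g (y - s)‖ ≤ G₂ * (2 * s) := h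
      _ ≤ 2 * G₂ * t := by nlinarith [hs.2, hG₂0]
  have hmain := Convex.norm_image_sub_le_of_norm_hasDerivWithin_le (f := fun s ↦ g (y + s) + g (y - s))
    (f' := fun s ↦ deriv g (y + s) - deriv g (y - s))
    (fun s _ ↦ (hφ' s).hasDerivWithinAt) hbound (convex_Icc 0 t)
    (left_mem_Icc.2 ht) (right_mem_Icc.2 ht)
  have e1 : (g (y + t) + g (y - t)) - (g (y + 0) + g (y - 0)) = -(2 * g y - g (y - t) - g (y + t)) := by
    simp only [add_zero, sub_zero]; ring
  rw [e1, norm_neg, sub_zero, Real.norm_of_nonneg ht] at hmain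
  calc ‖2 * g y - g (y - t) - g (y + t)‖ ≤ 2 * G₂ * t * t := hmain
    _ = 2 * G₂ * t ^ 2 := by ring
/-! ## The archimedean density: a global bound and the edge logarithm -/

/-- `ρ(t) ≤ 1/(2t) + 1/4` for `t > 0` (`t ρ(t) ≤ 1/2 + t/4`, tree). -/
theorem dt_weilArchDensity_le_inv {t : ℝ} (ht : 0 < t) : weilArchDensity t ≤ 1 / (2 * t) + 1 / 4 := by
  have h := mul_weilArchDensity_le ht
  rw [show 1 / (2 * t) + 1 / 4 = (1 / 2 + t / 4) / t by field_simp]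
  rw [le_div_iff₀ ht]
  linarith

/-- `ρ` is integrable on `[d, ∞)` for every `d > 0` (`ρ(s) ≤ e^{-s/2}/(1 − e^{-2d})` there). -/
theorem dt_integrableOn_weilArchDensity_Ici {d : ℝ} (hd : 0 < d) : IntegrableOn weilArchDensity (Ici d) := by
  have hq : 0 < 1 - Real.exp (-(4 * (d / 2))) := by
    rw [sub_pos, Real.exp_lt_one_iff]; linarith
  have h0 : IntegrableOn (fun s : ℝ ↦ Real.exp (-(1 / 2) * s) / (1 - Real.exp (-(4 * (d / 2))))) (Ioi (d / 2)) :=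
    (exp_neg_integrableOn_Ioi (d / 2) (by norm_num : (0 : ℝ) < 1 / 2)).div_const (1 - Real.exp (-(4 * (d / 2))))
  have hexp : IntegrableOn (fun s : ℝ ↦ Real.exp (-(1 / 2) * s) / (1 - Real.exp (-(4 * (d / 2))))) (Ici d) :=
    h0.mono_set (Ici_subset_Ioi.2 (by linarith))
  refine Integrable.mono' hexp measurable_weilArchDensity.aestronglyMeasurable.restrict ?_
  refine (ae_restrict_iff' measurableSet_Ici).2 (Eventually.of_forall fun s (hs : d ≤ s) ↦ ?_)
  have hs0 : 0 < s := lt_of_lt_of_le hd hs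
  rw [Real.norm_of_nonneg (weilArchDensity_pos hs0).le]
  have h := weilArchDensity_le_exp_neg (b := d / 2) (s := s) (by positivity) (by linarith)
  rwa [show -(s / 2) = -(1 / 2) * s by ring] at h

/-- **The edge logarithm**: for `0 < d`, `∫_d^∞ ρ ≤ (3/4) log⁺(1/d) + ∫_1^∞ ρ`
(on `[d, 1)` use `ρ(t) ≤ 1/(2t) + 1/4 ≤ 3/(4t)`). -/
theorem dt_setIntegral_weilArchDensity_Ici_le {d : ℝ} (hd : 0 < d) :
    ∫ t in Ici d, weilArchDensity t ≤
      3 / 4 * max 0 (-Real.log d) + ∫ t in Ici 1, weilArchDensity t := by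
  have hC₁ : 0 ≤ ∫ t in Ici (1 : ℝ), weilArchDensity t :=
    setIntegral_nonneg measurableSet_Ici fun t (ht : 1 ≤ t) ↦ (weilArchDensity_pos (by linarith)).le
  rcases le_or_gt 1 d with hd1 | hd1
  · -- `d ≥ 1`: `∫_d^∞ ρ ≤ ∫_1^∞ ρ`
    have hmono : ∫ t in Ici d, weilArchDensity t ≤ ∫ t in Ici 1, weilArchDensity t :=
      setIntegral_mono_set (dt_integrableOn_weilArchDensity_Ici one_pos)
        ((ae_restrict_iff' measurableSet_Ici).2 (Eventually.of_forall fun t (ht : 1 ≤ t) ↦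
          (weilArchDensity_pos (by linarith)).le))
        (Eventually.of_forall (Ici_subset_Ici.2 hd1))
    have : 0 ≤ 3 / 4 * max 0 (-Real.log d) := by positivity
    linarith
  · -- `d < 1`: split at `1`
    have hdisj : Disjoint (Ico d 1) (Ici (1 : ℝ)) :=
      Set.disjoint_left.2 fun t (ht : t ∈ Ico d 1) (ht' : t ∈ Ici 1) ↦ (not_le.2 ht.2) ht'
    have hsplit : ∫ t in Ici d, weilArchDensity t =
        (∫ t in Ico d 1, weilArchDensity t) + ∫ t in Ici 1, weilArchDensity t := by
      rw [← setIntegral_union hdisj measurableSet_Ici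
        ((dt_integrableOn_weilArchDensity_Ici hd).mono_set Ico_subset_Ici_self)
        (dt_integrableOn_weilArchDensity_Ici one_pos), Ico_union_Ici_eq_Ici hd1.le]
    -- on `[d, 1)`: `ρ ≤ 3/(4t)`
    have hIco : ∫ t in Ico d 1, weilArchDensity t ≤ ∫ t in Ico d 1, 3 / 4 * t⁻¹ := by
      have hint : IntegrableOn (fun t : ℝ ↦ 3 / 4 * t⁻¹) (Ico d 1) := by
        refine (ContinuousOn.integrableOn_compact isCompact_Icc ?_).mono_set Ico_subset_Icc_self
        exact (continuousOn_const.mul (continuousOn_inv₀.mono fun t (ht : t ∈ Icc d 1) ↦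
          (lt_of_lt_of_le hd ht.1).ne'))
      refine setIntegral_mono_on ((dt_integrableOn_weilArchDensity_Ici hd).mono_set Ico_subset_Ici_self)
        hint measurableSet_Ico fun t ht ↦ ?_
      have ht0 : 0 < t := lt_of_lt_of_le hd ht.1
      calc weilArchDensity t ≤ 1 / (2 * t) + 1 / 4 := dt_weilArchDensity_le_inv ht0
        _ ≤ 3 / 4 * t⁻¹ := by
            rw [show 1 / (2 * t) = (1 / 2) * t⁻¹ by rw [one_div, mul_inv]; ring]
            have : 1 ≤ t⁻¹ := (one_le_inv₀ ht0).2 ht.2.le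
            linarith
    have hval : ∫ t in Ico d 1, 3 / 4 * t⁻¹ = 3 / 4 * (-Real.log d) := by
      rw [setIntegral_congr_set Ico_ae_eq_Ioc, ← intervalIntegral.integral_of_le hd1.le,
        intervalIntegral.integral_const_mul, integral_inv_of_pos hd one_pos, one_div, Real.log_inv]
    have hmax : -Real.log d ≤ max 0 (-Real.log d) := le_max_right _ _
    rw [hsplit]
    linarith [hIco, hval]

/-- `log⁺(1/d) ≤ 4 d^{-1/4}` for `d > 0`. -/
theorem dt_negLog_le_rpow {d : ℝ} (hd : 0 < d) : max 0 (-Real.log d) ≤ 4 * d ^ (-(1 / 4 : ℝ)) := by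
  have hpos : 0 < d ^ (-(1 / 4 : ℝ)) := Real.rpow_pos_of_pos hd _
  refine max_le (by positivity) ?_
  have h := Real.log_le_rpow_div (x := d⁻¹) (inv_nonneg.2 hd.le) (by norm_num : (0 : ℝ) < 1 / 4)
  rw [Real.log_inv, Real.inv_rpow hd.le, ← Real.rpow_neg hd.le] at h
  linarith

/-! ## Integrability of `(c ∓ y)^{-1/4}` squared on the window -/

/-- `y ↦ (c - y)^{-1/2}` is integrable on `(-c, c)`. -/
theorem dt_integrableOn_rpow_sub {c : ℝ} (hc : 0 < c) :
    IntegrableOn (fun y : ℝ ↦ (c - y) ^ (-(1 / 2 : ℝ))) (Ioo (-c) c) := by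
  have h := (intervalIntegral.intervalIntegrable_rpow' (a := 0) (b := 2 * c)
    (by norm_num : (-1 : ℝ) < -(1 / 2))).comp_sub_left c
  rw [sub_zero, show c - 2 * c = -c by ring] at h
  have h' := h.symm
  rw [intervalIntegrable_iff_integrableOn_Ioo_of_le (by linarith)] at h'
  exact h'

/-- `y ↦ (c + y)^{-1/2}` is integrable on `(-c, c)`. -/
theorem dt_integrableOn_rpow_add {c : ℝ} (hc : 0 < c) :
    IntegrableOn (fun y : ℝ ↦ (c + y) ^ (-(1 / 2 : ℝ))) (Ioo (-c) c) := by
  have h := (intervalIntegral.intervalIntegrable_rpow' (a := 0) (b := 2 * c)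
    (by norm_num : (-1 : ℝ) < -(1 / 2))).comp_add_right c
  rw [zero_sub, show 2 * c - c = c by ring] at h
  rw [intervalIntegrable_iff_integrableOn_Ioo_of_le (by linarith)] at h
  refine h.congr_fun (fun y _ ↦ by rw [add_comm]) measurableSet_Ioo

/-- `𝟙_{(-c,c)}(y) (c - y)^{-1/4} ∈ L²(ℝ)`, and the same for `(c + y)^{-1/4}`. -/
theorem dt_memLp_indicator_rpow {c : ℝ} (hc : 0 < c) (σ : ℝ) (hσ : σ = 1 ∨ σ = -1) :
    MemLp ((Ioo (-c) c).indicator fun y : ℝ ↦ (c - σ * y) ^ (-(1 / 4 : ℝ))) 2 volume := by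
  rw [memLp_indicator_iff_restrict measurableSet_Ioo]
  have hmeas : AEStronglyMeasurable (fun y : ℝ ↦ (c - σ * y) ^ (-(1 / 4 : ℝ))) (volume.restrict (Ioo (-c) c)) :=
    ((measurable_const.sub (measurable_const.mul measurable_id)).pow_const _).aestronglyMeasurable
  rw [memLp_two_iff_integrable_sq_norm hmeas]
  have hint : IntegrableOn (fun y : ℝ ↦ (c - σ * y) ^ (-(1 / 2 : ℝ))) (Ioo (-c) c) := by
    rcases hσ with rfl | rfl
    · simpa only [one_mul] using dt_integrableOn_rpow_sub hc
    · simpa only [neg_mul, one_mul, sub_neg_eq_add] using dt_integrableOn_rpow_add hc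
  refine hint.congr_fun (fun y hy ↦ ?_) measurableSet_Ioo
  have hpos : 0 < c - σ * y := by
    rcases hσ with rfl | rfl
    · rw [one_mul]; linarith [hy.2]
    · rw [neg_mul, one_mul, sub_neg_eq_add]; linarith [hy.1]
  rw [Real.norm_of_nonneg (Real.rpow_nonneg hpos.le _), ← Real.rpow_natCast, ← Real.rpow_mul hpos.le]
  norm_num

/-! ## The majorant for `C²` window vectors -/

/-- **Archimedean majorant for a `C²` window vector.**  For `c > 0`, `g ∈ C²(ℝ)` and `v = g 𝟙_{[-c,c]}` (cast to
`ℂ`), there is `m ∈ L²(ℝ)` such that for every `y ∈ (-c, c)` the archimedean second differences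
`t ↦ ρ(t) |2v(y) − v(y−t) − v(y+t)|` are integrable on `(0, ∞)` with integral `≤ m(y)`.  (Inside the distance
`d(y) = c − |y|` to the edge the second differences are `≤ 2‖g''‖_∞ t²` and `ρ(t) t² ≤ t/2 + t²/4`; beyond it they
are `≤ 4‖g‖_∞` and `∫_d^∞ ρ ≤ (3/4) log⁺(1/d) + ∫_1^∞ ρ ≤ 3 d^{-1/4} + const`.) -/
theorem dt_exists_majorant_of_contDiff {c : ℝ} (hc : 0 < c) {g : ℝ → ℝ} (hg : ContDiff ℝ 2 g)
    {v : ℝ → ℂ} (hv : ∀ y, v y = (((Icc (-c) c).indicator g y : ℝ) : ℂ)) :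
    ∃ m : ℝ → ℝ, MemLp m 2 volume ∧
      (∀ y ∈ Ioo (-c) c,
        IntegrableOn (fun t ↦ weilArchDensity t * ‖2 * v y - v (y - t) - v (y + t)‖) (Ioi 0)) ∧
      (∀ y ∈ Ioo (-c) c,
        ∫ t in Ioi 0, weilArchDensity t * ‖2 * v y - v (y - t) - v (y + t)‖ ≤ m y) := by
  -- bounds for `g` and `g''` on the window
  obtain ⟨G₀, hG₀⟩ := isCompact_Icc.exists_bound_of_continuousOn
    (hg.continuous.continuousOn : ContinuousOn g (Icc (-c) c))
  obtain ⟨G₂, hG₂⟩ := isCompact_Icc.exists_bound_of_continuousOn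
    ((hg.continuous_iteratedDeriv 2 le_rfl).continuousOn : ContinuousOn (iteratedDeriv 2 g) (Icc (-c) c))
  have hG₀0 : 0 ≤ G₀ := (norm_nonneg _).trans (hG₀ 0 ⟨by linarith, by linarith⟩)
  have hG₂0 : 0 ≤ G₂ := (norm_nonneg _).trans (hG₂ 0 ⟨by linarith, by linarith⟩)
  set C₁ : ℝ := ∫ t in Ici (1 : ℝ), weilArchDensity t with hC₁
  have hC₁0 : 0 ≤ C₁ :=
    setIntegral_nonneg measurableSet_Ici fun t (ht : 1 ≤ t) ↦ (weilArchDensity_pos (by linarith)).le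
  set A₀ : ℝ := G₂ * (c + c ^ 2 / 2) with hA₀
  have hA₀0 : 0 ≤ A₀ := by positivity
  -- pointwise facts about `v`
  have hvb : ∀ z, ‖v z‖ ≤ G₀ := by
    intro z
    rw [hv z, Complex.norm_real]
    by_cases hz : z ∈ Icc (-c) c
    · rw [indicator_of_mem hz]; exact hG₀ z hz
    · rw [indicator_of_notMem hz, norm_zero]; exact hG₀0
  have hvin : ∀ z ∈ Icc (-c) c, v z = (g z : ℂ) := fun z hz ↦ by rw [hv z, indicator_of_mem hz]
  have hvm : Measurable v := by
    have e : v = fun y ↦ (((Icc (-c) c).indicator g y : ℝ) : ℂ) := funext hv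
    rw [e]
    exact Complex.measurable_ofReal.comp ((hg.continuous.measurable).indicator measurableSet_Icc)
  -- the majorant
  set m : ℝ → ℝ := (Ioo (-c) c).indicator fun y ↦
    A₀ * c + 4 * G₀ * (3 * ((c - 1 * y) ^ (-(1 / 4 : ℝ)) + (c - (-1) * y) ^ (-(1 / 4 : ℝ))) + C₁) with hm
  refine ⟨m, ?_, fun y hy ↦ ?_, fun y hy ↦ ?_⟩
  · -- `m ∈ L²`
    have e : m = (Ioo (-c) c).indicator (fun _ ↦ A₀ * c + 4 * G₀ * C₁) +
        ((12 * G₀) • (Ioo (-c) c).indicator (fun y : ℝ ↦ (c - 1 * y) ^ (-(1 / 4 : ℝ))) +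
          (12 * G₀) • (Ioo (-c) c).indicator (fun y : ℝ ↦ (c - (-1) * y) ^ (-(1 / 4 : ℝ)))) := by
      funext y
      simp only [hm, Pi.add_apply, Pi.smul_apply, smul_eq_mul]
      by_cases hy : y ∈ Ioo (-c) c
      · simp only [indicator_of_mem hy]; ring
      · simp only [indicator_of_notMem hy]; ring
    rw [e]
    have hvol : volume (Ioo (-c) c) ≠ ⊤ := by rw [Real.volume_Ioo]; exact ENNReal.ofReal_ne_top
    have m1 : MemLp ((Ioo (-c) c).indicator fun _ : ℝ ↦ A₀ * c + 4 * G₀ * C₁) 2 volume :=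
      memLp_indicator_const 2 measurableSet_Ioo _ (Or.inr hvol)
    have m2 := (dt_memLp_indicator_rpow hc 1 (Or.inl rfl)).const_smul (12 * G₀)
    have m3 := (dt_memLp_indicator_rpow hc (-1) (Or.inr rfl)).const_smul (12 * G₀)
    exact m1.add (m2.add m3)
  all_goals
    have hd : 0 < c - |y| := by
      rcases le_or_gt 0 y with h0 | h0
      · rw [abs_of_nonneg h0]; linarith [hy.2]
      · rw [abs_of_neg h0]; linarith [hy.1]
    set d : ℝ := c - |y| with hdd
    have hdc : d ≤ c := by rw [hdd]; linarith [abs_nonneg y]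
    have hyI : y ∈ Icc (-c) c := Ioo_subset_Icc_self hy
    -- the second differences: small `t`
    have hsmall : ∀ t ∈ Ioo 0 d, ‖2 * v y - v (y - t) - v (y + t)‖ ≤ 2 * G₂ * t ^ 2 := by
      intro t ht
      have hyt1 : y - t ∈ Icc (-c) c := by
        constructor
        · have : |y| < c - t := by rw [hdd] at ht; linarith [ht.2]
          linarith [neg_abs_le y, abs_lt.1 (lt_of_le_of_lt (le_refl |y|) this) |>.1, ht.1]
        · linarith [le_abs_self y, ht.1, hyI.2]
      have hyt2 : y + t ∈ Icc (-c) c := by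
        constructor
        · linarith [neg_abs_le y, ht.1, hyI.1]
        · have : |y| < c - t := by rw [hdd] at ht; linarith [ht.2]
          linarith [le_abs_self y]
      rw [hvin y hyI, hvin _ hyt1, hvin _ hyt2]
      have e : (2 : ℂ) * (g y : ℂ) - (g (y - t) : ℂ) - (g (y + t) : ℂ) =
          ((2 * g y - g (y - t) - g (y + t) : ℝ) : ℂ) := by push_cast; ring
      rw [e, Complex.norm_real]
      refine dt_secondDiff_norm_le hg ht.1.le fun s hs ↦ hG₂ s ⟨?_, ?_⟩
      · linarith [hs.1, hyt1.1]
      · linarith [hs.2, hyt2.2]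
    -- all `t`
    have hlarge : ∀ t, ‖2 * v y - v (y - t) - v (y + t)‖ ≤ 4 * G₀ := by
      intro t
      calc ‖2 * v y - v (y - t) - v (y + t)‖ ≤ ‖2 * v y - v (y - t)‖ + ‖v (y + t)‖ := norm_sub_le _ _
        _ ≤ ‖2 * v y‖ + ‖v (y - t)‖ + ‖v (y + t)‖ := by linarith [norm_sub_le (2 * v y) (v (y - t))]
        _ ≤ 2 * G₀ + G₀ + G₀ := by
            rw [norm_mul, Complex.norm_ofNat]
            linarith [hvb y, hvb (y - t), hvb (y + t)]
        _ = 4 * G₀ := by ring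
    -- the dominating function
    set H : ℝ → ℝ := fun t ↦ (Ioo 0 c).indicator (fun _ ↦ A₀) t +
      (Ici d).indicator (fun t ↦ 4 * G₀ * weilArchDensity t) t with hH
    have hvol0 : volume (Ioo (0 : ℝ) c) ≠ ⊤ := by rw [Real.volume_Ioo]; exact ENNReal.ofReal_ne_top
    have iA : IntegrableOn (fun _ : ℝ ↦ A₀) (Ioo 0 c) := integrableOn_const hvol0
    have iR : IntegrableOn (fun t ↦ 4 * G₀ * weilArchDensity t) (Ici d) :=
      (dt_integrableOn_weilArchDensity_Ici hd).const_mul _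
    have i1 : IntegrableOn (fun t ↦ (Ioo 0 c).indicator (fun _ ↦ A₀) t) (Ioi (0 : ℝ)) :=
      (iA.integrable_indicator measurableSet_Ioo).integrableOn
    have i2 : IntegrableOn (fun t ↦ (Ici d).indicator (fun t ↦ 4 * G₀ * weilArchDensity t) t) (Ioi (0 : ℝ)) :=
      (iR.integrable_indicator measurableSet_Ici).integrableOn
    have hHint : IntegrableOn H (Ioi 0) := i1.add i2
    have hdom : ∀ t ∈ Ioi (0 : ℝ), weilArchDensity t * ‖2 * v y - v (y - t) - v (y + t)‖ ≤ H t := by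
      intro t (ht : 0 < t)
      have hρ := (weilArchDensity_pos ht).le
      by_cases htd : t < d
      · have h1 : weilArchDensity t * ‖2 * v y - v (y - t) - v (y + t)‖ ≤ A₀ := by
          calc weilArchDensity t * ‖2 * v y - v (y - t) - v (y + t)‖
              ≤ weilArchDensity t * (2 * G₂ * t ^ 2) := mul_le_mul_of_nonneg_left (hsmall t ⟨ht, htd⟩) hρ
            _ = (t * weilArchDensity t) * (2 * G₂ * t) := by ring
            _ ≤ (1 / 2 + t / 4) * (2 * G₂ * t) :=
                mul_le_mul_of_nonneg_right (mul_weilArchDensity_le ht) (by positivity)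
            _ = G₂ * (t + t ^ 2 / 2) := by ring
            _ ≤ G₂ * (c + c ^ 2 / 2) := by
                refine mul_le_mul_of_nonneg_left ?_ hG₂0
                have htc : t ≤ c := (htd.le.trans hdc)
                nlinarith [ht.le]
        have h2 : A₀ ≤ H t := by
          rw [hH]
          simp only [indicator_of_mem (show t ∈ Ioo 0 c from ⟨ht, lt_of_lt_of_le htd hdc⟩)]
          have : 0 ≤ (Ici d).indicator (fun t ↦ 4 * G₀ * weilArchDensity t) t := by
            by_cases h : t ∈ Ici d
            · rw [indicator_of_mem h]; exact mul_nonneg (by positivity) hρ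
            · rw [indicator_of_notMem h]
          linarith
        exact h1.trans h2
      · have h1 : weilArchDensity t * ‖2 * v y - v (y - t) - v (y + t)‖ ≤ 4 * G₀ * weilArchDensity t := by
          calc weilArchDensity t * ‖2 * v y - v (y - t) - v (y + t)‖
              ≤ weilArchDensity t * (4 * G₀) := mul_le_mul_of_nonneg_left (hlarge t) hρ
            _ = 4 * G₀ * weilArchDensity t := by ring
        have h2 : 4 * G₀ * weilArchDensity t ≤ H t := by
          rw [hH]
          simp only [indicator_of_mem (show t ∈ Ici d from not_lt.1 htd)]
          have : 0 ≤ (Ioo 0 c).indicator (fun _ ↦ A₀) t := by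
            by_cases h : t ∈ Ioo 0 c
            · rw [indicator_of_mem h]; exact hA₀0
            · rw [indicator_of_notMem h]
          linarith
        exact h1.trans h2
    have hmeas : AEStronglyMeasurable (fun t ↦ weilArchDensity t * ‖2 * v y - v (y - t) - v (y + t)‖)
        (volume.restrict (Ioi 0)) := by
      refine (measurable_weilArchDensity.mul ?_).aestronglyMeasurable.restrict
      exact ((measurable_const.sub (hvm.comp (measurable_const.sub measurable_id))).sub
        (hvm.comp (measurable_const.add measurable_id))).norm
    have hint : IntegrableOn (fun t ↦ weilArchDensity t * ‖2 * v y - v (y - t) - v (y + t)‖) (Ioi 0) :=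
      Integrable.mono' hHint hmeas ((ae_restrict_iff' measurableSet_Ioi).2 (Eventually.of_forall
        fun t ht ↦ by
          rw [Real.norm_of_nonneg (mul_nonneg (weilArchDensity_pos ht).le (norm_nonneg _))]
          exact hdom t ht))
  · exact hint
  · -- the bound
    have h1 : ∫ t in Ioi 0, weilArchDensity t * ‖2 * v y - v (y - t) - v (y + t)‖ ≤ ∫ t in Ioi 0, H t :=
      setIntegral_mono_on hint hHint measurableSet_Ioi hdom
    have h2 : ∫ t in Ioi 0, H t = A₀ * c + 4 * G₀ * ∫ t in Ici d, weilArchDensity t := by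
      have e1 : ∫ t in Ioi 0, (Ioo 0 c).indicator (fun _ ↦ A₀) t = A₀ * c := by
        rw [integral_indicator measurableSet_Ioo, Measure.restrict_restrict measurableSet_Ioo,
          inter_eq_left.2 Ioo_subset_Ioi_self, setIntegral_const, Measure.real, Real.volume_Ioo, sub_zero,
          ENNReal.toReal_ofReal hc.le, smul_eq_mul, mul_comm]
      have e2 : ∫ t in Ioi 0, (Ici d).indicator (fun t ↦ 4 * G₀ * weilArchDensity t) t =
          4 * G₀ * ∫ t in Ici d, weilArchDensity t := by
        rw [integral_indicator measurableSet_Ici, Measure.restrict_restrict measurableSet_Ici,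
          inter_eq_left.2 (Ici_subset_Ioi.2 hd), integral_const_mul]
      simp only [hH]
      rw [integral_add i1 i2, e1, e2]
    have h3 := dt_setIntegral_weilArchDensity_Ici_le hd
    have h4 := dt_negLog_le_rpow hd
    -- `d^{-1/4} ≤ (c - y)^{-1/4} + (c + y)^{-1/4}`
    have h5 : d ^ (-(1 / 4 : ℝ)) ≤ (c - 1 * y) ^ (-(1 / 4 : ℝ)) + (c - (-1) * y) ^ (-(1 / 4 : ℝ)) := by
      have hcy : 0 < c - y := by linarith [hy.2]
      have hcy' : 0 < c + y := by linarith [hy.1]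
      rw [one_mul, neg_mul, one_mul, sub_neg_eq_add]
      rcases le_or_gt 0 y with h0 | h0
      · have hd' : d = c - y := by rw [hdd, abs_of_nonneg h0]
        rw [hd']
        linarith [Real.rpow_nonneg hcy'.le (-(1 / 4 : ℝ))]
      · have hd' : d = c + y := by rw [hdd, abs_of_neg h0]; ring
        rw [hd']
        linarith [Real.rpow_nonneg hcy.le (-(1 / 4 : ℝ))]
    have hmy : m y = A₀ * c + 4 * G₀ * (3 * ((c - 1 * y) ^ (-(1 / 4 : ℝ)) + (c - (-1) * y) ^ (-(1 / 4 : ℝ))) + C₁) := by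
      rw [hm, indicator_of_mem hy]
    rw [hmy]
    have h6 : ∫ t in Ici d, weilArchDensity t ≤
        3 * ((c - 1 * y) ^ (-(1 / 4 : ℝ)) + (c - (-1) * y) ^ (-(1 / 4 : ℝ))) + C₁ := by
      linarith [h3, h4, h5]
    calc ∫ t in Ioi 0, weilArchDensity t * ‖2 * v y - v (y - t) - v (y + t)‖
        ≤ A₀ * c + 4 * G₀ * ∫ t in Ici d, weilArchDensity t := by rw [← h2]; exact h1
      _ ≤ A₀ * c + 4 * G₀ * (3 * ((c - 1 * y) ^ (-(1 / 4 : ℝ)) + (c - (-1) * y) ^ (-(1 / 4 : ℝ))) + C₁) := by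
          have := mul_le_mul_of_nonneg_left h6 (by positivity : (0 : ℝ) ≤ 4 * G₀)
          linarith

end Summit.RiemannHypothesis.RiemannHypothesis.Theorems.EvenWinsBeyondArch

end
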